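import Literature.Topology.FourManifolds.HomotopySpheresBPProofs
import Literature.Topology.FourManifolds.HomotopySpheresIsMulExists
import HarnessLib

/-!
# `bP₄ₘ` is finite cyclic (Kervaire–Milnor Cor. 7.6), one dimension at a time

Topic `Literature/Topology/FourManifolds`; sibling proofs file of `HomotopySpheresBP.lean` and
`HomotopySpheresBPProofs.lean` for the named fact
`Literature.Topology.FourManifolds.HomotopySphereClass.isCyclic_bP_four_mul` (Kervaire–Milnor,
*Groups of homotopy spheres I*, Ann. of Math. 77 (1963), Cor. 7.6, p. 530: "The group `bP₄ₘ`,
`m > 1`, is isomorphic to a subgroup of the cyclic group of order `σₘ`. Hence `bP₄ₘ` is finite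
cyclic. The proof is evident."). Everything here is **proved**; no named fact is introduced.

## What the tree had, and what this file adds

`HomotopySpheresBPProofs.lean` proves the fact from the printed ingredients of the evident proof
(`HomotopySphereClass.isCyclic_bP_four_mul_of`): Lemma 7.4, Thm. 7.5, the additivity of `σ` over
connected sums (§2) and the two Lemma 3.4 comparisons — the five named facts of
`HomotopySpheresSignature.lean`, quantified over **all** dimensions `n + 1 = 4m` — together with two
shared inputs quantified over **all** `k`: the existence of products in `Θₖ`
(`HomotopySphereClass.isMul_exists`, for every `k`, hence including `Θ₂`, where the tree reduces it
to Morse theory on surfaces) and a generator convention `IsOrientableOver ℤ (𝔼 k) k`.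

Both shared inputs are in fact theorems of the tree in the dimensions that matter: products exist in
`Θₙ` for every `n ≥ 3` unconditionally (`HomotopySphereClass.isMul_exists_of_three_le`,
`HomotopySpheresIsMulExists.lean`: Kervaire–Milnor §2, p. 505, with the proved Hurewicz theorem),
and `ℝᵏ` is `ℤ`-orientable (`isOrientableOver_int_euclideanSpace`, Hatcher Prop. 3.25). This file
therefore records Cor. 7.6 in the sharper forms

* `HomotopySphereClass.exists_subgroup_coe_eq_bP_of_dim` — **pointwise**: in ONE dimension
  `n = 4m - 1`, for one `IsMul`-compatible commutative group structure on `Θₙ` and one generator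
  convention `g`, `bPₙ₊₁` is the carrier of a finite cyclic subgroup as soon as the five printed
  inputs hold in that dimension (so that `bP₈` needs the inputs at `n = 7`, `m = 2` only);
* `HomotopySphereClass.isCyclic_bP_four_mul_of_signatureFacts` — the named fact (all `m > 1`) from
  the five facts of `HomotopySpheresSignature.lean` **alone**; the eventual discharge
  `isCyclic_bP_four_mul_holds` is this theorem applied to their five `_holds`;
* `exists_commGroup_homotopySphereClass_isCyclic_seven_of_dim` — the dimension-`7` assembly of
  `Literature.Topology.FourManifolds.exists_commGroup_homotopySphereClass_isCyclic_seven` (`Θ₇` is cyclic) from a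
  compatible group structure on `Θ₇`, `Θ₇ = bP₈` (§4) and the five inputs at `n = 7`, `m = 2`.

The proof is the one of `HomotopySpheresBPProofs.lean` (Kervaire–Milnor p. 530), run in a single
dimension: by Lemma 7.4, `σₘ ≠ 0`; Thm. 7.5 makes `[Σ] ↦ σ(M) mod σₘ` a well-defined injection
`bPₙ₊₁ ↪ ℤ/σₘ`; §2-additivity and `IsMul`-compatibility make `bPₙ₊₁` closed under products and the
map multiplicative; a nonempty finite subset of a group closed under products is a subgroup
(`HomotopySphereClass.exists_subgroup_coe_eq_of_finite_of_mul_mem`), and a group embedding in the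
cyclic group `ℤ/σₘ` is cyclic.

## References

* M. Kervaire, J. Milnor, *Groups of homotopy spheres I*, Ann. of Math. 77 (1963), 504–537: §2
  (p. 505), Lemma 3.4 (p. 509), §4 (p. 512: `bPₙ₊₁` is a subgroup; table), §7: Lemma 7.4 and the
  definition of `σₘ` (p. 529), Thm. 7.5 (pp. 529–530), Cor. 7.6 (p. 530). [KervaireMilnorAnnals1963]
* A. Kosinski, *Differential Manifolds* (1993), Ch. X §6, Prop. 6.2(a). [Kosinski1993]
-/

open scoped Manifold ContDiff Topology
open Set Function

noncomputable section

namespace Literature.Topology.FourManifolds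

/-- Local notation: `𝔼 n` is the model Euclidean space `EuclideanSpace ℝ (Fin n)`. -/
local notation "𝔼 " n:arg => EuclideanSpace ℝ (Fin n)

/-- Local notation: `𝕊 n` is the unit sphere in `EuclideanSpace ℝ (Fin (n + 1))`. -/
local notation "𝕊 " n:arg => (Metric.sphere (0 : EuclideanSpace ℝ (Fin (n + 1))) 1)

namespace HomotopySphereClass

open HomotopySphere

variable {n : ℕ}

/-- **Kervaire–Milnor Cor. 7.6 in one dimension, from the §7 inputs in that dimension.** Let
`n + 1 = 4m`, fix a commutative group structure on `Θₙ = HomotopySphereClass n` whose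
multiplication is the connected sum (`IsMul a b c → a * b = c`) and a generator convention `g` for
`Hₙ(ℝⁿ | pt; ℤ)`. Assume, in this dimension and for this `g`: (Lemma 7.4) some nonzero integer is
the signature of an oriented s-parallelizable manifold bounded by the standard sphere; (Thm. 7.5)
for homotopy spheres `Σ₁`, `Σ₂` bounding oriented s-parallelizable `M₁`, `M₂`,
`[Σ₁] = [Σ₂] ↔ σₘ ∣ σ(M₁) - σ(M₂)`; (§2) signatures add over oriented connected sums; (Lemma 3.4,
both directions) "bounds a parallelizable manifold" iff "bounds an oriented s-parallelizable
manifold"; and products exist in `Θₙ`. Then `bPₙ₊₁ = bP n` is the carrier of a finite cyclic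
subgroup of `Θₙ`. Kervaire–Milnor 1963, p. 530: "The group `bP₄ₘ`, `m > 1`, is isomorphic to a
subgroup of the cyclic group of order `σₘ`. Hence `bP₄ₘ` is finite cyclic. The proof is evident."
(The hypothesis `m > 1` of Cor. 7.6 enters only through Thm. 7.5, here an assumption.) [cite: KervaireMilnorAnnals1963, Cor. 7.6 (p. 530), from Thm. 7.5, Lemma 7.4, §2 and §4 (p. 512)] -/
theorem exists_subgroup_coe_eq_bP_of_dim {m : ℕ} (h : n + 1 = 4 * m)
    [CommGroup (HomotopySphereClass n)]
    (hcompat : ∀ a b c : HomotopySphereClass n, IsMul a b c → a * b = c)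
    (g : Literature.AlgebraicTopology.SingularHomology.HomologicalOrientation ℤ (𝔼 n) n)
    (h74 : ∃ (o : SmoothOrientation (𝓡 n) (𝕊 n)) (σ : ℤ),
      σ ∈ signatureSet g m h ⟨𝕊 n, o, ⟨.refl _⟩⟩ ∧ σ ≠ 0)
    (h75 : ∀ (S T : HomotopySphere n) (σ τ : ℤ), σ ∈ signatureSet g m h S →
      τ ∈ signatureSet g m h T → (mk S = mk T ↔ (sigmaGen g m h : ℤ) ∣ σ - τ))
    (hadd : ∀ S T U : HomotopySphere n,
      IsOrientedConnectedSum S.orientation T.orientation U.orientation →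
        ∀ σ ∈ signatureSet g m h S, ∀ τ ∈ signatureSet g m h T, σ + τ ∈ signatureSet g m h U)
    (hne : ∀ S : HomotopySphere n, S.BoundsParallelizable → (signatureSet g m h S).Nonempty)
    (hbd : ∀ (S : HomotopySphere n) (σ : ℤ), σ ∈ signatureSet g m h S → S.BoundsParallelizable)
    (hmul : ∀ a b : HomotopySphereClass n, ∃ c, IsMul a b c) :
    ∃ H : Subgroup (HomotopySphereClass n),
      (H : Set (HomotopySphereClass n)) = bP n ∧ IsCyclic H ∧ Finite H := by
  classical
  -- Lemma 7.4: `σₘ ≠ 0`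
  obtain ⟨o₀, σ₀, hσ₀, hσ₀0⟩ := h74
  have hk : sigmaGen g m h ≠ 0 := sigmaGen_ne_zero (mem_sphereSignatureSubgroup hσ₀) hσ₀0
  haveI : NeZero (sigmaGen g m h) := ⟨hk⟩
  set k : ℕ := sigmaGen g m h with hk_def
  have hbP : ∀ {a : HomotopySphereClass n}, a ∈ bP n →
      ∃ S : HomotopySphere n, mk S = a ∧ S.BoundsParallelizable := fun ha => ha
  -- the value `σ(M) mod σₘ` of a class in `bP`, through chosen representatives
  let val : HomotopySphereClass n → ZMod k := fun a =>
    if ha : a ∈ bP n then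
      (((hne (hbP ha).choose (hbP ha).choose_spec.2).some : ℤ) : ZMod k)
    else 0
  -- Thm. 7.5 (⇒): the value does not depend on the choices
  have hval : ∀ (S : HomotopySphere n) (σ : ℤ), σ ∈ signatureSet g m h S →
      val (mk S) = (σ : ZMod k) := by
    intro S σ hσ
    have ha : mk S ∈ bP n := mk_mem_bP (hbd S σ hσ)
    simp only [val, dif_pos ha]
    have hS' := (hbP ha).choose_spec
    have hσ' := (hne (hbP ha).choose (hbP ha).choose_spec.2).some_mem
    have hdvd : (k : ℤ) ∣ _ - σ := (h75 _ S _ σ hσ' hσ).1 hS'.1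
    exact ((ZMod.intCast_eq_intCast_iff_dvd_sub σ _ k).2 hdvd).symm
  -- Thm. 7.5 (⇐): injectivity on `bP`
  have hinj : ∀ a ∈ bP n, ∀ b ∈ bP n, val a = val b → a = b := by
    rintro a ⟨S, rfl, hS⟩ b ⟨T, rfl, hT⟩ hab
    obtain ⟨σ, hσ⟩ := hne S hS
    obtain ⟨τ, hτ⟩ := hne T hT
    rw [hval S σ hσ, hval T τ hτ, ZMod.intCast_eq_intCast_iff_dvd_sub] at hab
    exact (h75 S T σ τ hσ hτ).2 ((dvd_sub_comm).1 hab)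
  -- §2: `bP` is closed under the product and `val` is multiplicative
  have hmulmem : ∀ a ∈ bP n, ∀ b ∈ bP n, a * b ∈ bP n ∧ val (a * b) = val a + val b := by
    intro a ha b hb
    obtain ⟨c, hc⟩ := hmul a b
    have habc : a * b = c := hcompat a b c hc
    obtain ⟨S, T, U, rfl, rfl, rfl, hsum⟩ := hc
    obtain ⟨σ, hσ⟩ := hne S (mk_mem_bP_iff.1 ha)
    obtain ⟨τ, hτ⟩ := hne T (mk_mem_bP_iff.1 hb)
    have hU : σ + τ ∈ signatureSet g m h U := hadd S T U hsum σ hσ τ hτ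
    refine ⟨habc ▸ mk_mem_bP (hbd U _ hU), ?_⟩
    rw [habc, hval U _ hU, hval S σ hσ, hval T τ hτ, Int.cast_add]
  -- `bP` is finite (it injects into `ℤ/σₘ`) and nonempty (`Sⁿ ∈ bP`, from Lemma 7.4)
  have hfin : (bP n).Finite :=
    Set.Finite.of_finite_image (Set.toFinite (val '' bP n)) fun a ha b hb => hinj a ha b hb
  have h1 : mk ⟨𝕊 n, o₀, ⟨.refl _⟩⟩ ∈ bP n := mk_mem_bP (hbd _ σ₀ hσ₀)
  -- hence a subgroup
  obtain ⟨H, hH⟩ := exists_subgroup_coe_eq_of_finite_of_mul_mem hfin ⟨_, h1⟩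
    fun a ha b hb => (hmulmem a ha b hb).1
  have hmemH : ∀ {a}, a ∈ H ↔ a ∈ bP n := fun {a} => by rw [← SetLike.mem_coe, hH]
  -- the injective homomorphism `bP → Multiplicative (ℤ/σₘ)`
  have hval1 : val 1 = 0 := by
    have := (hmulmem 1 (hmemH.1 H.one_mem) 1 (hmemH.1 H.one_mem)).2
    rw [mul_one] at this
    simpa using this
  let φ : H →* Multiplicative (ZMod k) :=
    { toFun := fun x => Multiplicative.ofAdd (val x)
      map_one' := by simp [hval1]
      map_mul' := fun x y => by
        rw [← ofAdd_add, Subgroup.coe_mul, (hmulmem x (hmemH.1 x.2) y (hmemH.1 y.2)).2] }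
  have hφ : Injective φ := fun x y hxy =>
    Subtype.ext (hinj x (hmemH.1 x.2) y (hmemH.1 y.2) (by simpa [φ] using hxy))
  -- conclusion
  refine ⟨H, hH, ?_, ?_⟩
  · exact isCyclic_of_surjective (MonoidHom.ofInjective hφ).symm
      (MonoidHom.ofInjective hφ).symm.surjective
  · have : Finite ↥(bP n) := hfin.to_subtype
    exact Finite.of_injective (fun x : H => (⟨x, hmemH.1 x.2⟩ : ↥(bP n)))
      fun x y hxy => Subtype.ext (congrArg Subtype.val hxy :)

/-- **Kervaire–Milnor Cor. 7.6 from the five §7 / §3 named facts alone.** The named fact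
`HomotopySphereClass.isCyclic_bP_four_mul` (`bP₄ₘ`, `m > 1`, is a finite cyclic subgroup of
`Θ₄ₘ₋₁` for every `IsMul`-compatible group structure) follows from Lemma 7.4
(`exists_mem_signatureSet_sphere_ne_zero`), Thm. 7.5 (`mk_eq_mk_iff_sigmaGen_dvd_sub`), the
additivity of signatures over connected sums (§2, `add_mem_signatureSet_of_isOrientedConnectedSum`)
and the two Lemma 3.4 comparisons (`nonempty_signatureSet_of_boundsParallelizable`,
`boundsParallelizable_of_mem_signatureSet`) — the remaining inputs of
`isCyclic_bP_four_mul_of` being theorems in the dimensions `n = 4m - 1 ≥ 7` at hand: products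
exist in `Θₙ`, `n ≥ 3` (`isMul_exists_of_three_le`, §2 p. 505) and `ℝⁿ` is `ℤ`-orientable
(`isOrientableOver_int_euclideanSpace`). Kervaire–Milnor 1963, p. 530: "The proof is evident."
[cite: KervaireMilnorAnnals1963, Cor. 7.6 (p. 530), from Thm. 7.5 and Lemma 7.4] -/
theorem isCyclic_bP_four_mul_of_signatureFacts
    (h74 : exists_mem_signatureSet_sphere_ne_zero)
    (h75 : mk_eq_mk_iff_sigmaGen_dvd_sub)
    (hadd : add_mem_signatureSet_of_isOrientedConnectedSum)
    (hne : nonempty_signatureSet_of_boundsParallelizable)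
    (hbd : boundsParallelizable_of_mem_signatureSet) :
    isCyclic_bP_four_mul := by
  intro m n hm h inst hcompat
  -- a generator convention for `Hₙ(ℝⁿ | pt; ℤ)` (Hatcher Prop. 3.25 for the contractible `ℝⁿ`)
  obtain ⟨g⟩ := isOrientableOver_int_euclideanSpace n
  exact exists_subgroup_coe_eq_bP_of_dim h hcompat g (h74 n m h (by omega) g) (h75 n m h hm g)
    (hadd n m h g) (hne n m h g) (hbd n m h g)
    (isMul_exists_of_three_le (n := n) (by omega) (by omega))

end HomotopySphereClass

/-! ### The dimension-`7` assembly from pointwise inputs -/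

/-- **`Θ₇` is cyclic from dimension-`7` inputs only.** If `Θ₇` carries a commutative group
structure whose multiplication is the connected sum, every homotopy `7`-sphere bounds a
parallelizable manifold (`HomotopySphere.boundsParallelizable_seven`, Kervaire–Milnor §4 with the
table p. 512: `Θ₇ = bP₈`), and, for one generator convention `g` of `H₇(ℝ⁷ | pt; ℤ)`, the five
printed inputs of Cor. 7.6 hold at `n = 7`, `m = 2` — Lemma 7.4 (a nonzero signature for `S⁷`),
Thm. 7.5 (`[Σ₁] = [Σ₂] ↔ σ₂ ∣ σ(M₁) - σ(M₂)`), §2-additivity of `σ` and the two Lemma 3.4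
comparisons — then `Θ₇` is a cyclic group under connected sum
(`Literature.Topology.FourManifolds.exists_commGroup_homotopySphereClass_isCyclic_seven`): by
`HomotopySphereClass.exists_subgroup_coe_eq_bP_of_dim` (products in `Θ₇` exist unconditionally,
`isMul_exists_of_three_le`) `bP₈` is the carrier of a cyclic subgroup, and `bP₈ = Θ₇`
(`HomotopySphereClass.bP_seven_eq_univ`). Refines
`exists_commGroup_homotopySphereClass_isCyclic_seven_of_commGroup` (`HomotopySpheresBPProofs.lean`),
which consumes Cor. 7.6 in all dimensions. [cite: KervaireMilnorAnnals1963, §4 p. 512 (table) and Cor. 7.6 (p. 530) at m = 2] -/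
theorem exists_commGroup_homotopySphereClass_isCyclic_seven_of_dim
    (hA7 : ∃ _ : CommGroup (HomotopySphereClass 7),
      ∀ a b c : HomotopySphereClass 7, HomotopySphereClass.IsMul a b c → a * b = c)
    (hB : HomotopySphere.boundsParallelizable_seven)
    (g : Literature.AlgebraicTopology.SingularHomology.HomologicalOrientation ℤ (𝔼 7) 7)
    (h : 7 + 1 = 4 * 2)
    (h74 : ∃ (o : SmoothOrientation (𝓡 7) (𝕊 7)) (σ : ℤ),
      σ ∈ HomotopySphere.signatureSet g 2 h ⟨𝕊 7, o, ⟨.refl _⟩⟩ ∧ σ ≠ 0)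
    (h75 : ∀ (S T : HomotopySphere 7) (σ τ : ℤ), σ ∈ HomotopySphere.signatureSet g 2 h S →
      τ ∈ HomotopySphere.signatureSet g 2 h T →
        (HomotopySphereClass.mk S = HomotopySphereClass.mk T ↔
          (HomotopySphere.sigmaGen g 2 h : ℤ) ∣ σ - τ))
    (hadd : ∀ S T U : HomotopySphere 7,
      IsOrientedConnectedSum S.orientation T.orientation U.orientation →
        ∀ σ ∈ HomotopySphere.signatureSet g 2 h S, ∀ τ ∈ HomotopySphere.signatureSet g 2 h T,
          σ + τ ∈ HomotopySphere.signatureSet g 2 h U)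
    (hne : ∀ S : HomotopySphere 7, S.BoundsParallelizable →
      (HomotopySphere.signatureSet g 2 h S).Nonempty)
    (hbd : ∀ (S : HomotopySphere 7) (σ : ℤ), σ ∈ HomotopySphere.signatureSet g 2 h S →
      S.BoundsParallelizable) :
    FourManifolds.exists_commGroup_homotopySphereClass_isCyclic_seven := by
  obtain ⟨inst, hmul⟩ := hA7
  refine ⟨inst, hmul, ?_⟩
  -- Cor. 7.6 at `m = 2`, `n = 7`: `bP₈` is the carrier of a cyclic subgroup `H`.
  obtain ⟨H, hH, hcyc, -⟩ := HomotopySphereClass.exists_subgroup_coe_eq_bP_of_dim h hmul g h74 h75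
    hadd hne hbd (HomotopySphereClass.isMul_exists_of_three_le (n := 7) (by norm_num) (by norm_num))
  -- (B): `bP₈ = Θ₇`, so `H = ⊤`.
  have htop : H = ⊤ := by
    rw [← SetLike.coe_set_eq, hH, HomotopySphereClass.bP_seven_eq_univ hB, Subgroup.coe_top]
  subst htop
  exact isCyclic_of_surjective (Subgroup.topEquiv : (⊤ : Subgroup (HomotopySphereClass 7)) ≃* _)
    Subgroup.topEquiv.surjective

end Literature.Topology.FourManifolds
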